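import Mathlib
import Literature.NumberTheory.Transcendental.KZIdealTetrahedron
import Literature.NumberTheory.Transcendental.SemialgebraicMapsProofs

/-!
# `IsometryMove`, line `bruhat-inversion-chain`: transport of `[σ, t⁻³]` along one move

Stub `stub_moveTransport` of the crux `IsometryMove` (stmt-KontsevichZagierPeriods-3471, route
HyperbolicBloch). Given a map `Φ` of `ℝ³` (coordinates `p 0 = x`, `p 1 = y`, `p 2 = t`) which, on the
domain `σ ⊆ {t > 0}` of a KZ integral representation `r = [σ, t⁻³]`, is `ℚ`-semialgebraic, injective,
maps into `{t > 0}` and has a derivative `Φ'` within `σ` with the Jacobian identity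
`t⁻³ = (Φ p)₂⁻³ · |det Φ' p|`, we

* BUILD the image representation `[Φ σ, t⁻³]`: the image is `ℚ`-semialgebraic by Tarski–Seidenberg
  (`IsSemialgebraicMapOn.isSemialgebraic_image_holds`), `t⁻³` is a `ℚ`-semialgebraic function on it
  (`isSemialgebraicFunOn_one_div_cube`), and `t⁻³` is integrable on `Φ σ` by Mathlib's
  change-of-variables criterion `MeasureTheory.integrableOn_image_iff_integrableOn_abs_det_fderiv_smul`
  (the pulled-back integrand `|det Φ'| · (Φ p)₂⁻³` IS `t⁻³ = r.integrand` on `σ`);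
* show that EVERY representation `r'` with domain `Φ σ` and integrand `t⁻³` there is KZ-equivalent to
  `r`, by exhibiting the single element `[r] − [r']` of `KZ.changeOfVariablesRel`
  (Kontsevich–Zagier's rule (2)).

References: M. Kontsevich, D. Zagier, *Periods* (2001), §1.2 rule (2); J. Bochnak, M. Coste,
M.-F. Roy, *Real Algebraic Geometry* (1998), Prop. 2.2.7.
-/

noncomputable section

open Set MeasureTheory
open Literature.NumberTheory.Transcendental Literature.ModelTheory.ExponentialFields

namespace Summit.KontsevichZagierPeriods.HyperbolicBloch.IsometryMove

/-- The pulled-back density: if `r.integrand = t⁻³` on `r.domain` and `t⁻³ = (Φ p)₂⁻³ · |det Φ' p|`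
there, then `t⁻³` is integrable on the image `Φ '' r.domain` (Mathlib's Jacobian criterion
`MeasureTheory.integrableOn_image_iff_integrableOn_abs_det_fderiv_smul`, the pulled-back integrand
being `r.integrand` itself on `r.domain`). [cite: KontsevichZagier2001, §1.2 rule (2)] -/
theorem transport_integrableOn_image (Φ : (Fin 3 → ℝ) → (Fin 3 → ℝ))
    (Φ' : (Fin 3 → ℝ) → ((Fin 3 → ℝ) →L[ℝ] (Fin 3 → ℝ))) (r : KZ.IntegralRep 3)
    (hint : EqOn r.integrand (fun p => 1 / p 2 ^ 3) r.domain) (hinj : InjOn Φ r.domain)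
    (hΦ' : ∀ x ∈ r.domain, HasFDerivWithinAt Φ (Φ' x) r.domain x ∧
      1 / x 2 ^ 3 = 1 / (Φ x) 2 ^ 3 * |(Φ' x).det|) :
    IntegrableOn (fun p : Fin 3 → ℝ => 1 / p 2 ^ 3) (Φ '' r.domain) := by
  have hmeas : MeasurableSet r.domain := KZ.IntegralRep.measurableSet_domain_holds r
  rw [integrableOn_image_iff_integrableOn_abs_det_fderiv_smul volume hmeas (fun x hx => (hΦ' x hx).1)
    hinj]
  refine r.integrableOn.congr_fun (fun x hx => ?_) hmeas
  calc r.integrand x = 1 / x 2 ^ 3 := hint hx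
    _ = 1 / (Φ x) 2 ^ 3 * |(Φ' x).det| := (hΦ' x hx).2
    _ = |(Φ' x).det| • (1 / (Φ x) 2 ^ 3) := by rw [smul_eq_mul, mul_comm]

/-- **Transport along one move** (stub `stub_moveTransport` of line `bruhat-inversion-chain`). If `Φ` is
`ℚ`-semialgebraic and injective on the domain `σ ⊆ {t > 0}` of a representation `r = [σ, t⁻³]`, maps it
into `{t > 0}` and has there a derivative with `t⁻³ = (Φ p)₂⁻³ · |det DΦ|`, then `[Φ σ, t⁻³]` IS an
integral representation (semialgebraic image by Tarski–Seidenberg; integrability by the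
change-of-variables formula) and every representation with domain `Φ σ` and integrand `t⁻³` there is
KZ-equivalent to `r` by ONE `KZ.changeOfVariablesRel` move. [cite: KontsevichZagier2001, §1.2 rule (2)] -/
theorem stub_moveTransport : ∀ (Φ : (Fin 3 → ℝ) → (Fin 3 → ℝ)) (r : Literature.NumberTheory.Transcendental.KZ.IntegralRep 3), r.domain ⊆ {p | 0 < p 2} → Set.EqOn r.integrand (fun p => 1 / p 2 ^ 3) r.domain → Literature.NumberTheory.Transcendental.IsSemialgebraicMapOn ℚ r.domain Φ → Set.InjOn Φ r.domain → Set.MapsTo Φ r.domain {p | 0 < p 2} → (∃ Φ' : (Fin 3 → ℝ) → ((Fin 3 → ℝ) →L[ℝ] (Fin 3 → ℝ)), ∀ x ∈ r.domain, HasFDerivWithinAt Φ (Φ' x) r.domain x ∧ 1 / x 2 ^ 3 = 1 / (Φ x) 2 ^ 3 * |(Φ' x).det|) → (∃ r₁ : Literature.NumberTheory.Transcendental.KZ.IntegralRep 3, r₁.domain = Φ '' r.domain ∧ Set.EqOn r₁.integrand (fun p => 1 / p 2 ^ 3) r₁.domain) ∧ (∀ r' : Literature.NumberTheory.Transcendental.KZ.IntegralRep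 3, r'.domain = Φ '' r.domain → Set.EqOn r'.integrand (fun p => 1 / p 2 ^ 3) r'.domain → Literature.NumberTheory.Transcendental.KZ.Equivalent r r') := by
  intro Φ r _ hint hΦ hinj hmaps hex
  obtain ⟨Φ', hΦ'⟩ := hex
  -- the image lies in the open upper half-space
  have himg : Φ '' r.domain ⊆ {p | 0 < p 2} := by
    rintro _ ⟨x, hx, rfl⟩
    exact hmaps hx
  -- the image is `ℚ`-semialgebraic (Tarski–Seidenberg)
  have hT : IsSemialgebraic ℚ (Φ '' r.domain) :=
    IsSemialgebraicMapOn.isSemialgebraic_image_holds hΦ subset_rfl r.isSemialgebraic_domain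
  -- `t⁻³` is a `ℚ`-semialgebraic function on the image
  have hF : IsSemialgebraicFunOn ℚ (Φ '' r.domain) (fun p : Fin 3 → ℝ => 1 / p 2 ^ 3) :=
    isSemialgebraicFunOn_one_div_cube hT himg
  -- `t⁻³` is integrable on the image (change of variables)
  have hI : IntegrableOn (fun p : Fin 3 → ℝ => 1 / p 2 ^ 3) (Φ '' r.domain) :=
    transport_integrableOn_image Φ Φ' r hint hinj hΦ'
  refine ⟨⟨⟨Φ '' r.domain, fun p => 1 / p 2 ^ 3, hT, hF, hI⟩, rfl, fun _ _ => rfl⟩, ?_⟩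
  -- the move `[r] − [r'] ∈ changeOfVariablesRel`
  intro r' hdom hint'
  refine KZ.changeOfVariablesRel_subset_relations
    ⟨3, r, r', Φ, Φ', hΦ, fun x hx => (hΦ' x hx).1, hinj, hdom, fun x hx => ?_, rfl⟩
  have hx' : Φ x ∈ r'.domain := hdom ▸ mem_image_of_mem Φ hx
  have h2 : r'.integrand (Φ x) = 1 / (Φ x) 2 ^ 3 := hint' hx'
  calc r.integrand x = 1 / x 2 ^ 3 := hint hx
    _ = 1 / (Φ x) 2 ^ 3 * |(Φ' x).det| := (hΦ' x hx).2
    _ = r'.integrand (Φ x) * |(Φ' x).det| := by rw [h2]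

end Summit.KontsevichZagierPeriods.HyperbolicBloch.IsometryMove

end
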